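import Literature.NumberTheory.Weil1964.AdelicSiegelParabolicLift
import Literature.NumberTheory.Weil1964.DoublingDiagonalPolarisation
import Literature.NumberTheory.Automorphic.UnitaryGroupSymplecticRationalPoints
import HarnessLib

/-!
# The doubling diagonal `Sp(W) → Sp(W ⊕ W⁻)`, its conjugate into the Siegel parabolic of `𝕐 = δ(W^Δ)`, and the
# adelic doubling lift `S̃ : Sp(W_𝔸) →* Mp_ψ((W ⊕ W⁻)_𝔸)ᶜᵒⁿᵗ`

Topic `NumberTheory/Weil1964`; namespace `Literature.NumberTheory.Weil1964`.  KERNEL MATHEMATICS ONLY: definitions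
with bodies and theorems; no `def … : Prop` record, no `axiom`, no proof hole; the cite tags are provenance for
kernel-checked statements.  (Lane `lit-hodgefound`, prover row P-C2-16, STAGE 2 of the staged construction of the
compatible splitting [GelbartRogawski1991, Prop. 3.1.1] over a unitary dual pair — sequel of
`AdelicSiegelParabolicLift` (STAGE 1); nothing in this file is a statement about a unitary group.)

THE PRINTED MATHEMATICS.  The DOUBLING of [GelbartPiatetskishapiroRallis1987, Part A §2 pp. 7–9]: "*Let `W = V ⊕ V`
and define a form `<,>` on `W` by `<(v₁,v₂),(v₁',v₂')> = (v₁,v₁') − (v₂,v₂')` … if we let `V^d = {(v,v) ∈ W}` be the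
image of the diagonal embedding of `V` in `W` then … `V^d` is isotropic … let `P` be the parabolic subgroup of `H`
preserving `V^d`.  There is an embedding `i : G × G → H` … The stabilizer of `V^d` in `G × G` is `(G × G) ∩ P` … so
indeed `G^d = (G × G) ∩ P`*"; in the language of [Kudla1996, V.3]: "*identify `W_{2n}` with the "doubled" symplectic
space `W_n + W_n⁻`, where `W_n⁻` is the space `W_n` with the negative of its original symplectic form.  We thus
obtain a homomorphism `G_n × G_n → G_{2n}`*".  With Li's rational symplectic matrix `δ` carrying `W^Δ` onto the
standard Lagrangian `𝕐` of the doubled space (`DoublingDiagonalPolarisation`, [Li1992, p. 181]), the conjugate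
`g ↦ δ g^Δ δ⁻¹` lands in the Siegel parabolic `P_𝕐` of `AdelicSiegelParabolicLift`, over ANY commutative ring.
Adelically, composing with Weil's canonical lift `𝐫₀` over `P_𝕐(𝔸)` [Weil1964, Chap. I n° 13 p. 160] and conjugating
back by Weil's `Θ`-forced rational lift `r_F(δ)` [Weil1964, Chap. III n° 40 p. 190, n° 41 Thm 6 p. 193] gives a
HOMOMORPHIC lift of the diagonal of `Sp(W_𝔸)` into `Mp_ψ((W ⊕ W⁻)_𝔸)ᶜᵒⁿᵗ` which, at RATIONAL points, is the
`Θ`-forced rational lift of the (rational) diagonal point.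

WHAT IS HERE (all proved):
* §1 (`AdelicSiegelParabolicLift` complement) the blocks `a_p, c_p` of a TRANSPORTED matrix `p = P⁻¹AP`
  (`SiegelParabolicPi.aMat_transportSp`, `cMat_transportSp`: `a_p = A₁₁`, `c_p = A₁₁ᵀ A₂₁`), whence
  **`𝐫₀ = r_F` at EVERY rational point of `P_Y(𝔸)`** (`adelicSiegelLift_mem_adelicMpTheta_of_mem_range`,
  `adelicSiegelLiftCont_eq_ratPointsThetaLiftCont_of_mem_range`) — STAGE 1 had it on the subgroup generated by the
  rational Levi and unipotent elements; here for all of `P_Y(𝔸) ∩ Sp_F(W)`;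
* §2 (any commutative ring `K`, Gram matrix `T`, doubled Gram matrix `T ⊕ (−T)`): `spNeg` (`Sp(W, β_T) = Sp(W⁻, β_{−T})`),
  the **diagonal `spDiag T : Sp(W) →* Sp(W ⊕ W⁻)`** (`= spSum T (−T) ∘ (id, spNeg)` of `UnitaryGroupDirectSum`),
  `doublingDelta` (`δ` transported), **`doublingConj`/`doublingParabolic : Sp(W) →* P_𝕐`** (`δ g^Δ δ⁻¹ ∈ P_𝕐`:
  `δ⁻¹ 𝕐 = W^Δ` is `g^Δ`-stable); more generally the **stabiliser `stabDiag T ≤ Sp(W ⊕ W⁻)` of the diagonal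
  Lagrangian `W^Δ`** (`IsDiag`, `spDiag_mem_stabDiag`, `spDiagStab`) and **`stabDiagParabolic : Stab(W^Δ) →* P_𝕐`**,
  `p ↦ δ p δ⁻¹`; and the MATRIX of the diagonal in Darboux coordinates
  (`diagSpMatrix : Sp_{2ι}(K) →* Sp_{2(ι⊕ι)}(K)`, `coe_diagSpMatrix`, `mapHom_diagSpMatrix`, `transportSp_diagSpMatrix`:
  the diagonal is defined over the prime ring, so it carries rational points to rational points);
* §3 reindexing preserves `P_Y` (`siegelParabolicPiReindex`);
* §4 (adelic, `T ∈ GL_n(𝔸_F)`, doubled Gram matrix `doubledGramFin T = reindex (T ⊕ −T)` on `Fin (n + n)`):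
  `doublingParabolicFin`, `stabDiagParabolicFin` (values in `P_Y((W ⊕ W⁻)_𝔸)`), the rational point `doublingDeltaRat`
  with `ratSp_doublingDeltaRat`, `spReindex_spDiag_ratSp` (the diagonal of a rational point is rational), Weil's
  `r_F(δ) = doublingDeltaLift`, **THE LIFT OVER THE ADELIC STABILISER OF `W^Δ`**
  `stabDiagLift F T hT : Stab(W^Δ)(𝔸) →* Mp_ψ((W ⊕ W⁻)_𝔸)ᶜᵒⁿᵗ`, `p ↦ r_F(δ)⁻¹ · 𝐫₀(δ p δ⁻¹) · r_F(δ)` with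
  `proj_stabDiagLift` and **`stabDiagLift_eq_ratPointsThetaLiftCont`** (`= r_F` at EVERY rational point of the
  stabiliser), and its restriction to the diagonal, **THE DOUBLING LIFT `doublingLift F T hT : Sp(W_𝔸) →*
  Mp_ψ((W ⊕ W⁻)_𝔸)ᶜᵒⁿᵗ`**, `S̃(g) = r_F(δ)⁻¹ · 𝐫₀(δ g^Δ δ⁻¹) · r_F(δ)`, with `proj_doublingLift` (`π ∘ S̃ = Δ`) and
  **`doublingLift_ratSp`** (`S̃(ratSp γ) = r_F((ratSp γ)^Δ)`);
* §5 the **splitting data** of [GelbartRogawski1991, §3.1] at `G(𝐀) := Stab(W^Δ)(𝔸)` (`G(F) :=` all its rational points)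
  and at `G(𝐀) := Sp(W_𝔸)` with `ι := Δ` (`G(F) := Sp_F(W)`), all fields constructed, and
  **`isCompatible_stabDiagLift`**, **`isCompatible_doublingLift`**: the lifts ARE compatible splittings in the sense
  of `GelbartRogawski1991.SplittingDatum.IsCompatible` (homomorphic, over `ι`, rational points into `r_F(Sp_F(W ⊕ W⁻))`).
  Continuity for a topology on `Sp(W_𝔸)` / `Stab(W^Δ)(𝔸)` is not asserted (no such topology is in the tree);
  consumers compose `stabDiagParabolicFin` with `continuous_adelicSiegelLift_comp` along their own continuous families.

## References

* [GelbartPiatetskishapiroRallis1987] S. Gelbart, I. Piatetski-Shapiro, S. Rallis, *Explicit Constructions of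
  Automorphic L-Functions*, LNM 1254 (1987), Part A §2 pp. 7–9 (`W = V ⊕ V`, `<,> = (,) ⊕ −(,)`, `V^d`, `P`,
  `i : G × G → H`, `G^d = (G × G) ∩ P`).
* [Kudla1996] S. S. Kudla, *Notes on the local theta correspondence* (1996), V.3 (the doubled space `W_n + W_n⁻`,
  `G_n × G_n → G_{2n}`).
* [Li1992] J.-S. Li, J. reine angew. Math. 428 (1992) 177–217, p. 181 (`δ`).
* [Weil1964] A. Weil, *Sur certains groupes d'opérateurs unitaires*, Acta Math. 111 (1964): Chap. I n° 13 p. 160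
  (`𝐫₀` on `P₀`), Chap. III n° 37 p. 188 (rational points), n° 40 p. 190 (`r_k`), n° 41 Thm 6 p. 193
  (`Θ`-invariance), n° 46 pp. 201–202 (`P(X)`, normal form (42)).
* [GelbartRogawski1991] S. Gelbart, J. Rogawski, Invent. Math. 105 (1991), §3.1 p. 454 (the datum), Remark p. 457
  (compatible splittings).
-/

set_option autoImplicit false

noncomputable section

namespace Literature.NumberTheory.Weil1964

open Literature.RepresentationTheory.HeisenbergGroup
open Literature.RepresentationTheory.HeisenbergGroup.SymplecticMatrix
open Literature.NumberTheory.Automorphic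
open Literature.NumberTheory.Automorphic.UnitaryGroup (spSum coe_spSum spSumEquiv_apply spReindex reindexW
  coe_spReindex_apply reindexW_apply reindexW_symm_apply)
open Literature.NumberTheory.Automorphic.UnitaryGroup.SpTransport (untransportMatrix untransportMatrix_mulVec
  untransportMatrix_mem untransportSp coe_untransportSp transportSp_untransportSp)
open NumberField
open scoped Matrix

/-! ## §1 `𝐫₀ = r_F` at EVERY rational point of `P_Y(𝔸)` -/

section RationalParabolic

variable {K : Type*} [CommRing K] {ι : Type*} [Fintype ι] [DecidableEq ι] (T : Matrix ι ι K) (hT : IsUnit T.det)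

local notation "𝕎" => (ι → K) × (ι → K)
local notation "Sp𝕎" => symplecticGroup (polar (Matrix.toLinearMap₂' K T))

namespace SiegelParabolicPi

/-- the blocks of a transported symplectic matrix on `X`: `(P⁻¹AP)(x, 0) = (A₁₁ x, T⁻¹ A₂₁ x)` (`P = darboux T`).
[cite: Weil1964, Chap. III n° 46 p. 202] -/
theorem transportSp_apply_inl (A : Matrix.symplecticGroup ι K) (x : ι → K) :
    ((transportSp T hT A : Sp𝕎) : 𝕎 ≃ₗ[K] 𝕎) (x, 0) =
      ((A : Matrix (ι ⊕ ι) (ι ⊕ ι) K).toBlocks₁₁ *ᵥ x,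
        T⁻¹ *ᵥ ((A : Matrix (ι ⊕ ι) (ι ⊕ ι) K).toBlocks₂₁ *ᵥ x)) := by
  rw [coe_transportSp_apply, darboux_apply]
  dsimp only
  rw [Matrix.mulVec_zero]
  conv_lhs => rw [← Matrix.fromBlocks_toBlocks (A : Matrix (ι ⊕ ι) (ι ⊕ ι) K)]
  rw [Matrix.fromBlocks_mulVec, Sum.elim_comp_inl, Sum.elim_comp_inr, Matrix.mulVec_zero, Matrix.mulVec_zero,
    add_zero, add_zero, darboux_symm_sumElim]

/-- `a_{P⁻¹AP} = A₁₁`. [cite: Weil1964, Chap. III n° 46 p. 202] -/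
theorem aMat_transportSp (A : Matrix.symplecticGroup ι K) :
    aMat (transportSp T hT A) = (A : Matrix (ι ⊕ ι) (ι ⊕ ι) K).toBlocks₁₁ :=
  Matrix.ext_iff_mulVec.2 fun x => by rw [aMat_mulVec, transportSp_apply_inl]

/-- `a⁻¹_{P⁻¹AP} = (A⁻¹)₁₁`. [cite: Weil1964, Chap. III n° 46 p. 202] -/
theorem aInvMat_transportSp (A : Matrix.symplecticGroup ι K) :
    aInvMat (transportSp T hT A) = ((A⁻¹ : Matrix.symplecticGroup ι K) : Matrix (ι ⊕ ι) (ι ⊕ ι) K).toBlocks₁₁ :=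
  Matrix.ext_iff_mulVec.2 fun x => by
    have h : ((transportSp T hT A : Sp𝕎) : 𝕎 ≃ₗ[K] 𝕎).symm = ((transportSp T hT A⁻¹ : Sp𝕎) : 𝕎 ≃ₗ[K] 𝕎) := by
      rw [map_inv]; rfl
    rw [aInvMat_mulVec, h, transportSp_apply_inl]

/-- `d_{P⁻¹AP} = T⁻¹ A₂₁`. [cite: Weil1964, Chap. III n° 46 p. 202] -/
theorem dMat_transportSp (A : Matrix.symplecticGroup ι K) :
    dMat (transportSp T hT A) = T⁻¹ * (A : Matrix (ι ⊕ ι) (ι ⊕ ι) K).toBlocks₂₁ :=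
  Matrix.ext_iff_mulVec.2 fun x => by rw [dMat_mulVec, transportSp_apply_inl, Matrix.mulVec_mulVec]

/-- `c_{P⁻¹AP} = A₁₁ᵀ A₂₁`. [cite: Weil1964, Chap. III n° 46 p. 202] -/
theorem cMat_transportSp (A : Matrix.symplecticGroup ι K) :
    cMat (transportSp T hT A) =
      (A : Matrix (ι ⊕ ι) (ι ⊕ ι) K).toBlocks₁₁ᵀ * (A : Matrix (ι ⊕ ι) (ι ⊕ ι) K).toBlocks₂₁ := by
  rw [cMat, aMat_transportSp, dMat_transportSp, Matrix.mul_assoc, Matrix.mul_nonsing_inv_cancel_left T _ hT]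

end SiegelParabolicPi

end RationalParabolic

/-- blocks commute with entrywise maps. [folklore] -/
private theorem toBlocks₁₁_map {m α β : Type*} (A : Matrix (m ⊕ m) (m ⊕ m) α) (f : α → β) :
    (A.map f).toBlocks₁₁ = A.toBlocks₁₁.map f := rfl

/-- blocks commute with entrywise maps. [folklore] -/
private theorem toBlocks₂₁_map {m α β : Type*} (A : Matrix (m ⊕ m) (m ⊕ m) α) (f : α → β) :
    (A.map f).toBlocks₂₁ = A.toBlocks₂₁.map f := rfl

section RationalParabolicAdelic

variable (F : Type) [Field F] [NumberField F] {n : ℕ}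
variable (T : Matrix (Fin n) (Fin n) (AdeleRing (𝓞 F) F)) (hT : IsUnit T.det)

local notation "𝔸F" => AdeleRing (𝓞 F) F
local notation "Sp𝔸" => symplecticGroup (polar (adelicForm F (Fin n) T))
local notation "M₂F" => Matrix (Fin n ⊕ Fin n) (Fin n ⊕ Fin n) F

/-- **`𝐫₀` FIXES `Θ` AT EVERY RATIONAL POINT OF `P_Y(𝔸)`**: if `ratSp P₀ ∈ P_Y(𝔸)` for `P₀ ∈ Sp_{2n}(F)`, then
`a_p = (P₀)₁₁ ⊗ 1 ∈ GL_n(F)` and `c_p = ((P₀)₁₁ᵀ (P₀)₂₁) ⊗ 1 ∈ Sym_n(F)` are rational, so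
`𝐫₀(p) = leviPair(γ) · unipPair(σ)` fixes `Θ` (`thetaDist_twist_ratGL`, `thetaDist_chirp_ratMatrix`).
[cite: Weil1964, Chap. III n° 41 Thm 6 p. 193] -/
theorem adelicSiegelLift_mem_adelicMpTheta_of_eq_ratSp (P₀ : Matrix.symplecticGroup (Fin n) F)
    (hp : ratSp F T hT P₀ ∈ siegelParabolicPi T) :
    adelicSiegelLift F T hT ⟨ratSp F T hT P₀, hp⟩ ∈ adelicMpTheta F (Fin n) T := by
  haveI : Nontrivial 𝔸F :=
    inferInstanceAs (Nontrivial (InfiniteAdeleRing F × IsDedekindDomain.FiniteAdeleRing (𝓞 F) F))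
  have hrat : ratSp F T hT P₀ = transportSp T hT (mapHom (algebraMap F 𝔸F) P₀) := rfl
  have ha : SiegelParabolicPi.aMat (ratSp F T hT P₀) = ((P₀ : M₂F).toBlocks₁₁).map (algebraMap F 𝔸F) := by
    rw [hrat, SiegelParabolicPi.aMat_transportSp, coe_mapHom, toBlocks₁₁_map]
  have ha' : SiegelParabolicPi.aInvMat (ratSp F T hT P₀) =
      (((P₀⁻¹ : Matrix.symplecticGroup (Fin n) F) : M₂F).toBlocks₁₁).map (algebraMap F 𝔸F) := by
    rw [hrat, SiegelParabolicPi.aInvMat_transportSp, ← map_inv, coe_mapHom, toBlocks₁₁_map]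
  have hc : SiegelParabolicPi.cMat (ratSp F T hT P₀) =
      ((P₀ : M₂F).toBlocks₁₁ᵀ * (P₀ : M₂F).toBlocks₂₁).map (algebraMap F 𝔸F) := by
    rw [hrat, SiegelParabolicPi.cMat_transportSp _ hT, coe_mapHom, toBlocks₁₁_map, toBlocks₂₁_map, Matrix.map_mul,
      Matrix.transpose_map]
  have h1 : (P₀ : M₂F).toBlocks₁₁ * ((P₀⁻¹ : Matrix.symplecticGroup (Fin n) F) : M₂F).toBlocks₁₁ = 1 :=
    Matrix.map_injective (algebraMap F 𝔸F).injective (by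
      beta_reduce
      rw [Matrix.map_mul, Matrix.map_one _ (map_zero _) (map_one _), ← ha, ← ha']
      exact SiegelParabolicPi.aMat_mul_aInvMat hp)
  have h2 : ((P₀⁻¹ : Matrix.symplecticGroup (Fin n) F) : M₂F).toBlocks₁₁ * (P₀ : M₂F).toBlocks₁₁ = 1 :=
    Matrix.map_injective (algebraMap F 𝔸F).injective (by
      beta_reduce
      rw [Matrix.map_mul, Matrix.map_one _ (map_zero _) (map_one _), ← ha, ← ha']
      exact SiegelParabolicPi.aInvMat_mul_aMat hp)
  let γ : GL (Fin n) F := ⟨_, _, h1, h2⟩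
  have hγ : SiegelParabolicPi.aGL hp = ratGL F γ := Units.ext ha
  have key₁ : ∀ a : GL (Fin n) 𝔸F, a = ratGL F γ → leviPair F T hT a ∈ adelicMpTheta F (Fin n) T := by
    rintro a rfl
    exact leviPair_ratGL_mem_adelicMpTheta F T hT γ
  have key₂ : ∀ (c : Matrix (Fin n) (Fin n) 𝔸F) (hc' : c.IsSymm),
      c = ((P₀ : M₂F).toBlocks₁₁ᵀ * (P₀ : M₂F).toBlocks₂₁).map (algebraMap F 𝔸F) →
        unipPair F T hT c hc' ∈ adelicMpTheta F (Fin n) T := by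
    rintro c hc' rfl
    exact unipPair_ratMatrix_mem_adelicMpTheta F T hT _ hc'
  rw [adelicSiegelLift_eq_leviPair_mul_unipPair]
  exact Subgroup.mul_mem _ (key₁ _ hγ) (key₂ _ _ hc)

/-- **`𝐫₀ = r_F` ON `P_Y(𝔸) ∩ Sp_F(W)`** (membership form): at every rational point of the adelic Siegel
parabolic, Weil's canonical lift fixes `Θ`. [cite: Weil1964, Chap. III n° 41 Thm 6 p. 193] -/
theorem adelicSiegelLift_mem_adelicMpTheta_of_mem_range {p : siegelParabolicPi T}
    (hp : (p : Sp𝔸) ∈ (ratSp F T hT).range) : adelicSiegelLift F T hT p ∈ adelicMpTheta F (Fin n) T := by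
  obtain ⟨P₀, hP₀⟩ := hp
  have hmem : ratSp F T hT P₀ ∈ siegelParabolicPi T := hP₀ ▸ p.2
  have h : p = ⟨ratSp F T hT P₀, hmem⟩ := Subtype.ext hP₀.symm
  rw [h]
  exact adelicSiegelLift_mem_adelicMpTheta_of_eq_ratSp F T hT P₀ hmem

/-- **`𝐫₀ = r_F` ON `P_Y(𝔸) ∩ Sp_F(W)`**: Weil's canonical lift IS the `Θ`-forced rational lift at every rational
point of the Siegel parabolic (`Θ`-rigidity). [cite: Weil1964, Chap. III n° 41 Thm 6 p. 193] -/
theorem adelicSiegelLiftCont_eq_ratPointsThetaLiftCont_of_mem_range {p : siegelParabolicPi T}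
    (hp : (p : Sp𝔸) ∈ (ratSp F T hT).range) :
    adelicSiegelLiftCont F T hT p = ratPointsThetaLiftCont F (Fin n) T hT ⟨(p : Sp𝔸), hp⟩ :=
  Subtype.ext (coe_ratPointsThetaLiftCont_eq F (Fin n) T hT
    (adelicSiegelLift_mem_adelicMpTheta_of_mem_range F T hT hp) (proj_adelicSiegelLift F T hT p)).symm

end RationalParabolicAdelic

/-! ## §2 The diagonal `g ↦ g^Δ` of `Sp(W)` in `Sp(W ⊕ W⁻)` and its conjugate `δ g^Δ δ⁻¹ ∈ P_𝕐` -/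

/-! ### diagonal vectors of `W ⊕ W⁻` -/

section DiagVec

variable {K : Type*} {ι : Type*}

local notation "𝕎₂" => (ι ⊕ ι → K) × (ι ⊕ ι → K)

/-- a vector of `W ⊕ W⁻` lies on the diagonal `W^Δ = {(w, w)}`: its two halves agree (in the `X`- and in the
`Y`-coordinates). [cite: GelbartPiatetskishapiroRallis1987, Part A §2 pp. 7–9] -/
def IsDiag (v : 𝕎₂) : Prop := v.1 ∘ Sum.inl = v.1 ∘ Sum.inr ∧ v.2 ∘ Sum.inl = v.2 ∘ Sum.inr

/-- diagonal vectors are diagonal. [cite: GelbartPiatetskishapiroRallis1987, Part A §2 pp. 7–9] -/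
theorem isDiag_diag (x y : ι → K) : IsDiag ((Sum.elim x x, Sum.elim y y) : 𝕎₂) :=
  ⟨(Sum.elim_comp_inl x x).trans (Sum.elim_comp_inr x x).symm, (Sum.elim_comp_inl y y).trans (Sum.elim_comp_inr y y).symm⟩

/-- a diagonal vector is `((a, a), (b, b))` with `a, b` its left halves. [cite: GelbartPiatetskishapiroRallis1987, Part A §2 pp. 7–9] -/
theorem IsDiag.eq {v : 𝕎₂} (hv : IsDiag v) :
    v = (Sum.elim (v.1 ∘ Sum.inl) (v.1 ∘ Sum.inl), Sum.elim (v.2 ∘ Sum.inl) (v.2 ∘ Sum.inl)) := by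
  obtain ⟨x, y⟩ := v
  obtain ⟨h1, h2⟩ := hv
  dsimp only at h1 h2 ⊢
  refine Prod.ext ?_ ?_
  · conv_lhs => rw [← Sum.elim_comp_inl_inr x]
    rw [← h1]
  · conv_lhs => rw [← Sum.elim_comp_inl_inr y]
    rw [← h2]

end DiagVec

section Diagonal

variable {K : Type*} [CommRing K] {ι : Type*} [Fintype ι] [DecidableEq ι] (T : Matrix ι ι K)

local notation "𝕎" => (ι → K) × (ι → K)
local notation "𝕎₂" => (ι ⊕ ι → K) × (ι ⊕ ι → K)
local notation "Sp𝕎" => symplecticGroup (polar (Matrix.toLinearMap₂' K T))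
local notation "T₂" => Matrix.fromBlocks T 0 0 (-T)
local notation "Sp𝕎₂" => symplecticGroup (polar (Matrix.toLinearMap₂' K (Matrix.fromBlocks T 0 0 (-T))))

/-- **`Sp(W, β_T) = Sp(W⁻, β_{−T})`**: the same automorphisms preserve the negated form (`W⁻ =` "the space `W`
with the negative of its original symplectic form"). [cite: Kudla1996, V.3] -/
def spNeg : Sp𝕎 →* symplecticGroup (polar (Matrix.toLinearMap₂' K (-T))) where
  toFun g := ⟨(g : 𝕎 ≃ₗ[K] 𝕎), by
    have hg := (mem_symplecticGroup _ _).1 g.2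
    rw [mem_symplecticGroup]
    intro w w'
    have h := hg w w'
    simp only [polar_apply, Matrix.toLinearMap₂'_apply', Matrix.neg_mulVec, dotProduct_neg] at h ⊢
    linear_combination -h⟩
  map_one' := rfl
  map_mul' _ _ := rfl

/-- underlying automorphism of `spNeg g` is that of `g`. [cite: Kudla1996, V.3] -/
@[simp] theorem coe_spNeg (g : Sp𝕎) :
    ((spNeg T g : symplecticGroup (polar (Matrix.toLinearMap₂' K (-T)))) : 𝕎 ≃ₗ[K] 𝕎) = (g : 𝕎 ≃ₗ[K] 𝕎) :=
  rfl

/-- **the diagonal `g ↦ g^Δ = g ⊕ g` of `Sp(W)` in `Sp(W ⊕ W⁻)`** (Gram matrix `T ⊕ (−T)`): the image of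
`(g, g)` under `G × G → Sp(W + W⁻)` ("identify `W_{2n}` with the doubled symplectic space `W_n + W_n⁻` … we
thus obtain a homomorphism `G_n × G_n → G_{2n}`"). [cite: Kudla1996, V.3] -/
def spDiag : Sp𝕎 →* Sp𝕎₂ := (spSum T (-T)).comp ((MonoidHom.id _).prod (spNeg T))

/-- formula for `g^Δ`. [cite: Kudla1996, V.3] -/
theorem coe_spDiag_apply (g : Sp𝕎) (v : 𝕎₂) :
    ((spDiag T g : Sp𝕎₂) : 𝕎₂ ≃ₗ[K] 𝕎₂) v =
      (Sum.elim ((g : 𝕎 ≃ₗ[K] 𝕎) (v.1 ∘ Sum.inl, v.2 ∘ Sum.inl)).1 ((g : 𝕎 ≃ₗ[K] 𝕎) (v.1 ∘ Sum.inr, v.2 ∘ Sum.inr)).1,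
        Sum.elim ((g : 𝕎 ≃ₗ[K] 𝕎) (v.1 ∘ Sum.inl, v.2 ∘ Sum.inl)).2
          ((g : 𝕎 ≃ₗ[K] 𝕎) (v.1 ∘ Sum.inr, v.2 ∘ Sum.inr)).2) :=
  rfl

/-- `g^Δ` on a diagonal vector: `g^Δ((x, x), (y, y)) = ((a, a), (b, b))`, `(a, b) = g(x, y)` — `g^Δ` preserves
`W^Δ`; "the stabilizer of `V^d` in `G × G` is `G^d`". [cite: GelbartPiatetskishapiroRallis1987, Part A §2 pp. 7–9] -/
theorem coe_spDiag_apply_diag (g : Sp𝕎) (x y : ι → K) :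
    ((spDiag T g : Sp𝕎₂) : 𝕎₂ ≃ₗ[K] 𝕎₂) (Sum.elim x x, Sum.elim y y) =
      (Sum.elim ((g : 𝕎 ≃ₗ[K] 𝕎) (x, y)).1 ((g : 𝕎 ≃ₗ[K] 𝕎) (x, y)).1,
        Sum.elim ((g : 𝕎 ≃ₗ[K] 𝕎) (x, y)).2 ((g : 𝕎 ≃ₗ[K] 𝕎) (x, y)).2) := by
  rw [coe_spDiag_apply]
  simp only [Sum.elim_comp_inl, Sum.elim_comp_inr]

variable (hT : IsUnit T.det)

/-- **`δ ∈ Sp(𝕎, β_{T ⊕ −T})`** carrying `W^Δ` onto `𝕐` (the transport of `deltaDiag`). [cite: Li1992, p. 181] -/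
def doublingDelta : Sp𝕎₂ := transportSp T₂ (isUnit_det_fromBlocks_neg T hT) (deltaDiag K ι)

/-- `δ⁻¹(0, (y₁, y₂)) = ((T y₂, T y₂), (y₁, y₁)) ∈ W^Δ`. [cite: Li1992, p. 181] -/
theorem doublingDelta_symm_apply_zero (y : ι ⊕ ι → K) :
    ((doublingDelta T hT : Sp𝕎₂) : 𝕎₂ ≃ₗ[K] 𝕎₂).symm (0, y) =
      (Sum.elim (T *ᵥ (y ∘ Sum.inr)) (T *ᵥ (y ∘ Sum.inr)), Sum.elim (y ∘ Sum.inl) (y ∘ Sum.inl)) := by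
  rw [LinearEquiv.symm_apply_eq, doublingDelta, transportSp_deltaDiag_diag, Sum.elim_comp_inl_inr]

/-- `δ((a, a), (b, b)) = (0, (b, T⁻¹ a))`: `δ(W^Δ) = 𝕐`. [cite: Li1992, p. 181] -/
theorem doublingDelta_apply_diag (a b : ι → K) :
    ((doublingDelta T hT : Sp𝕎₂) : 𝕎₂ ≃ₗ[K] 𝕎₂) (Sum.elim a a, Sum.elim b b) = (0, Sum.elim b (T⁻¹ *ᵥ a)) := by
  have ha : a = T *ᵥ (T⁻¹ *ᵥ a) := by
    rw [Matrix.mulVec_mulVec, Matrix.mul_nonsing_inv T hT, Matrix.one_mulVec]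
  conv_lhs => rw [ha]
  exact transportSp_deltaDiag_diag T (isUnit_det_fromBlocks_neg T hT) b (T⁻¹ *ᵥ a)

/-- **`g ↦ δ g^Δ δ⁻¹`**: the diagonal conjugated into the Siegel parabolic of `𝕐 = δ(W^Δ)`.
[cite: GelbartPiatetskishapiroRallis1987, Part A §2 pp. 7–9] -/
def doublingConj : Sp𝕎 →* Sp𝕎₂ := (MulAut.conj (doublingDelta T hT)).toMonoidHom.comp (spDiag T)

/-- unfolding. [cite: GelbartPiatetskishapiroRallis1987, Part A §2 pp. 7–9] -/
theorem doublingConj_apply (g : Sp𝕎) :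
    doublingConj T hT g = doublingDelta T hT * spDiag T g * (doublingDelta T hT)⁻¹ := rfl

/-- `(δ g^Δ δ⁻¹)(0, y)` has zero `𝕏`-component: `δ g^Δ δ⁻¹` preserves `𝕐`.
[cite: GelbartPiatetskishapiroRallis1987, Part A §2 pp. 7–9] -/
theorem doublingConj_apply_zero_fst (g : Sp𝕎) (y : ι ⊕ ι → K) :
    (((doublingConj T hT g : Sp𝕎₂) : 𝕎₂ ≃ₗ[K] 𝕎₂) (0, y)).1 = 0 := by
  have h : ((doublingConj T hT g : Sp𝕎₂) : 𝕎₂ ≃ₗ[K] 𝕎₂) (0, y) =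
      ((doublingDelta T hT : Sp𝕎₂) : 𝕎₂ ≃ₗ[K] 𝕎₂) (((spDiag T g : Sp𝕎₂) : 𝕎₂ ≃ₗ[K] 𝕎₂)
        (((doublingDelta T hT : Sp𝕎₂) : 𝕎₂ ≃ₗ[K] 𝕎₂).symm (0, y))) := rfl
  rw [h, doublingDelta_symm_apply_zero, coe_spDiag_apply_diag, doublingDelta_apply_diag]

/-- **`δ g^Δ δ⁻¹ ∈ P_𝕐`** for every `g ∈ Sp(W)` ("`G^d = (G × G) ∩ P`", transported by `δ`).
[cite: GelbartPiatetskishapiroRallis1987, Part A §2 pp. 7–9] -/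
theorem doublingConj_mem_siegelParabolicPi (g : Sp𝕎) : doublingConj T hT g ∈ siegelParabolicPi T₂ := by
  refine ⟨fun y => doublingConj_apply_zero_fst T hT g y, fun y => ?_⟩
  have h : ((doublingConj T hT g : Sp𝕎₂) : 𝕎₂ ≃ₗ[K] 𝕎₂).symm (0, y) =
      ((doublingConj T hT g⁻¹ : Sp𝕎₂) : 𝕎₂ ≃ₗ[K] 𝕎₂) (0, y) := by
    rw [map_inv]; rfl
  rw [h]
  exact doublingConj_apply_zero_fst T hT g⁻¹ y

/-- **`g ↦ δ g^Δ δ⁻¹ : Sp(W) →* P_𝕐`**. [cite: GelbartPiatetskishapiroRallis1987, Part A §2 pp. 7–9] -/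
def doublingParabolic : Sp𝕎 →* siegelParabolicPi T₂ :=
  (doublingConj T hT).codRestrict _ (doublingConj_mem_siegelParabolicPi T hT)

/-- underlying element. [cite: GelbartPiatetskishapiroRallis1987, Part A §2 pp. 7–9] -/
@[simp] theorem coe_doublingParabolic (g : Sp𝕎) :
    (doublingParabolic T hT g : Sp𝕎₂) = doublingDelta T hT * spDiag T g * (doublingDelta T hT)⁻¹ := rfl

/-! ### the stabiliser of the diagonal Lagrangian `W^Δ` and its conjugate `δ · δ⁻¹ ≤ P_𝕐` -/

/-- **the stabiliser of the diagonal Lagrangian `W^Δ` in `Sp(W ⊕ W⁻)`** (`p(W^Δ) ⊆ W^Δ` and `p⁻¹(W^Δ) ⊆ W^Δ`) — the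
parabolic "`P` preserving `V^d`" of the doubling method, on the symplectic side. [cite: GelbartPiatetskishapiroRallis1987, Part A §2 pp. 7–9] -/
def stabDiag : Subgroup Sp𝕎₂ where
  carrier := {p | (∀ v : 𝕎₂, IsDiag v → IsDiag (((p : Sp𝕎₂) : 𝕎₂ ≃ₗ[K] 𝕎₂) v)) ∧
    ∀ v : 𝕎₂, IsDiag v → IsDiag (((p : Sp𝕎₂) : 𝕎₂ ≃ₗ[K] 𝕎₂).symm v)}
  one_mem' := ⟨fun _ hv => hv, fun _ hv => hv⟩
  mul_mem' {p q} hp hq := ⟨fun v hv => hp.1 _ (hq.1 v hv), fun v hv => hq.2 _ (hp.2 v hv)⟩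
  inv_mem' {p} hp := by
    refine ⟨fun v hv => hp.2 v hv, fun v hv => ?_⟩
    show IsDiag (((p : Sp𝕎₂) : 𝕎₂ ≃ₗ[K] 𝕎₂).symm.symm v)
    rw [LinearEquiv.symm_symm]
    exact hp.1 v hv

/-- membership. [cite: GelbartPiatetskishapiroRallis1987, Part A §2 pp. 7–9] -/
theorem mem_stabDiag_iff (p : Sp𝕎₂) :
    p ∈ stabDiag T ↔ (∀ v : 𝕎₂, IsDiag v → IsDiag ((p : 𝕎₂ ≃ₗ[K] 𝕎₂) v)) ∧
      ∀ v : 𝕎₂, IsDiag v → IsDiag ((p : 𝕎₂ ≃ₗ[K] 𝕎₂).symm v) :=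
  Iff.rfl

/-- **`g^Δ` stabilises `W^Δ`** ("the stabilizer of `V^d` in `G × G` is `G^d`" — the easy inclusion).
[cite: GelbartPiatetskishapiroRallis1987, Part A §2 pp. 7–9] -/
theorem spDiag_mem_stabDiag (g : Sp𝕎) : spDiag T g ∈ stabDiag T := by
  have key : ∀ (g : Sp𝕎) (v : 𝕎₂), IsDiag v → IsDiag (((spDiag T g : Sp𝕎₂) : 𝕎₂ ≃ₗ[K] 𝕎₂) v) := by
    intro g v hv
    rw [hv.eq, coe_spDiag_apply_diag]
    exact isDiag_diag _ _
  refine ⟨key g, fun v hv => ?_⟩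
  have h : ((spDiag T g : Sp𝕎₂) : 𝕎₂ ≃ₗ[K] 𝕎₂).symm v = ((spDiag T g⁻¹ : Sp𝕎₂) : 𝕎₂ ≃ₗ[K] 𝕎₂) v := by
    rw [map_inv]; rfl
  rw [h]
  exact key g⁻¹ v hv

/-- `g ↦ g^Δ` with values in the stabiliser of `W^Δ`. [cite: GelbartPiatetskishapiroRallis1987, Part A §2 pp. 7–9] -/
def spDiagStab : Sp𝕎 →* stabDiag T := (spDiag T).codRestrict _ (spDiag_mem_stabDiag T)

/-- underlying element. [cite: GelbartPiatetskishapiroRallis1987, Part A §2 pp. 7–9] -/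
@[simp] theorem coe_spDiagStab (g : Sp𝕎) : (spDiagStab T g : Sp𝕎₂) = spDiag T g := rfl

/-- `(δ p δ⁻¹)(0, y)` has zero `𝕏`-component when `p` maps `W^Δ` into itself. [cite: Li1992, p. 181] -/
theorem conj_doublingDelta_apply_zero_fst {p : Sp𝕎₂} (hp : ∀ v : 𝕎₂, IsDiag v → IsDiag ((p : 𝕎₂ ≃ₗ[K] 𝕎₂) v))
    (y : ι ⊕ ι → K) :
    (((doublingDelta T hT * p * (doublingDelta T hT)⁻¹ : Sp𝕎₂) : 𝕎₂ ≃ₗ[K] 𝕎₂) (0, y)).1 = 0 := by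
  have h : ((doublingDelta T hT * p * (doublingDelta T hT)⁻¹ : Sp𝕎₂) : 𝕎₂ ≃ₗ[K] 𝕎₂) (0, y) =
      ((doublingDelta T hT : Sp𝕎₂) : 𝕎₂ ≃ₗ[K] 𝕎₂) ((p : 𝕎₂ ≃ₗ[K] 𝕎₂)
        (((doublingDelta T hT : Sp𝕎₂) : 𝕎₂ ≃ₗ[K] 𝕎₂).symm (0, y))) := rfl
  rw [h, doublingDelta_symm_apply_zero, (hp _ (isDiag_diag _ _)).eq, doublingDelta_apply_diag]

/-- **`δ · Stab(W^Δ) · δ⁻¹ ≤ P_𝕐`**: conjugation by `δ` carries the stabiliser of the diagonal Lagrangian into the Siegel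
parabolic of `𝕐 = δ(W^Δ)`. [cite: Li1992, p. 181] -/
theorem conj_doublingDelta_mem_siegelParabolicPi {p : Sp𝕎₂} (hp : p ∈ stabDiag T) :
    doublingDelta T hT * p * (doublingDelta T hT)⁻¹ ∈ siegelParabolicPi T₂ := by
  refine ⟨fun y => conj_doublingDelta_apply_zero_fst T hT hp.1 y, fun y => ?_⟩
  have hp' : ∀ v : 𝕎₂, IsDiag v → IsDiag (((p⁻¹ : Sp𝕎₂) : 𝕎₂ ≃ₗ[K] 𝕎₂) v) := hp.2
  have h : ((doublingDelta T hT * p * (doublingDelta T hT)⁻¹ : Sp𝕎₂) : 𝕎₂ ≃ₗ[K] 𝕎₂).symm (0, y) =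
      ((doublingDelta T hT * p⁻¹ * (doublingDelta T hT)⁻¹ : Sp𝕎₂) : 𝕎₂ ≃ₗ[K] 𝕎₂) (0, y) := by
    rw [show doublingDelta T hT * p⁻¹ * (doublingDelta T hT)⁻¹ = (doublingDelta T hT * p * (doublingDelta T hT)⁻¹)⁻¹ by
      group]
    rfl
  rw [h]
  exact conj_doublingDelta_apply_zero_fst T hT hp' y

/-- **`p ↦ δ p δ⁻¹ : Stab(W^Δ) →* P_𝕐`**. [cite: Li1992, p. 181] -/
def stabDiagParabolic : stabDiag T →* siegelParabolicPi T₂ :=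
  ((MulAut.conj (doublingDelta T hT)).toMonoidHom.comp (stabDiag T).subtype).codRestrict _ fun p =>
    conj_doublingDelta_mem_siegelParabolicPi T hT p.2

/-- underlying element. [cite: Li1992, p. 181] -/
@[simp] theorem coe_stabDiagParabolic (p : stabDiag T) :
    (stabDiagParabolic T hT p : Sp𝕎₂) = doublingDelta T hT * p * (doublingDelta T hT)⁻¹ := rfl

/-- on the diagonal it is `doublingParabolic`. [cite: GelbartPiatetskishapiroRallis1987, Part A §2 pp. 7–9] -/
theorem stabDiagParabolic_spDiagStab (g : Sp𝕎) :
    stabDiagParabolic T hT (spDiagStab T g) = doublingParabolic T hT g := rfl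

/-! ### the matrix of `g^Δ` in Darboux coordinates (rational points go to rational points) -/

/-- the block matrix of the diagonal in the Darboux coordinates of `W ⊕ W⁻`: for `A = (a b; c d)`,
`D(A) = ((a ⊕ a) (b ⊕ −b); (c ⊕ −c) (d ⊕ d))`. [cite: Kudla1996, V.3] -/
def diagSpMatrixAux (A : Matrix (ι ⊕ ι) (ι ⊕ ι) K) : Matrix ((ι ⊕ ι) ⊕ (ι ⊕ ι)) ((ι ⊕ ι) ⊕ (ι ⊕ ι)) K :=
  Matrix.fromBlocks (Matrix.fromBlocks A.toBlocks₁₁ 0 0 A.toBlocks₁₁)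
    (Matrix.fromBlocks A.toBlocks₁₂ 0 0 (-A.toBlocks₁₂))
    (Matrix.fromBlocks A.toBlocks₂₁ 0 0 (-A.toBlocks₂₁)) (Matrix.fromBlocks A.toBlocks₂₂ 0 0 A.toBlocks₂₂)

omit [Fintype ι] [DecidableEq ι] in
/-- `D` commutes with change of scalars. [cite: Kudla1996, V.3] -/
theorem diagSpMatrixAux_map {K' : Type*} [CommRing K'] (f : K →+* K') (A : Matrix (ι ⊕ ι) (ι ⊕ ι) K) :
    (diagSpMatrixAux A).map f = diagSpMatrixAux (A.map f) := by
  simp only [diagSpMatrixAux, Matrix.fromBlocks_map, Matrix.map_zero _ (map_zero f), Matrix.map_neg _ (map_neg f)]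
  rfl

/-- `(P⁻¹AP)(x', y') = (A₁₁ x' + A₁₂ T y', T⁻¹ (A₂₁ x' + A₂₂ T y'))`. [cite: Weil1964, Chap. III n° 46 p. 202] -/
theorem coe_transportSp_apply_blocks (A : Matrix.symplecticGroup ι K) (x' y' : ι → K) :
    ((transportSp T hT A : Sp𝕎) : 𝕎 ≃ₗ[K] 𝕎) (x', y') =
      ((A : Matrix (ι ⊕ ι) (ι ⊕ ι) K).toBlocks₁₁ *ᵥ x' + (A : Matrix (ι ⊕ ι) (ι ⊕ ι) K).toBlocks₁₂ *ᵥ (T *ᵥ y'),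
        T⁻¹ *ᵥ ((A : Matrix (ι ⊕ ι) (ι ⊕ ι) K).toBlocks₂₁ *ᵥ x' +
          (A : Matrix (ι ⊕ ι) (ι ⊕ ι) K).toBlocks₂₂ *ᵥ (T *ᵥ y'))) := by
  rw [coe_transportSp_apply, darboux_apply]
  dsimp only
  conv_lhs => rw [← Matrix.fromBlocks_toBlocks (A : Matrix (ι ⊕ ι) (ι ⊕ ι) K)]
  rw [Matrix.fromBlocks_mulVec, Sum.elim_comp_inl, Sum.elim_comp_inr, darboux_symm_sumElim]

/-- **`D(A)` is the Darboux matrix of `(P⁻¹AP)^Δ`**: `D(A) · P₂ v = P₂ ((P⁻¹AP)^Δ v)`, `P₂ = darboux (T ⊕ −T)`.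
[cite: Kudla1996, V.3] -/
theorem diagSpMatrixAux_mulVec_darboux (A : Matrix.symplecticGroup ι K) (v : 𝕎₂) :
    diagSpMatrixAux (A : Matrix (ι ⊕ ι) (ι ⊕ ι) K) *ᵥ darboux T₂ (isUnit_det_fromBlocks_neg T hT) v =
      darboux T₂ (isUnit_det_fromBlocks_neg T hT) (((spDiag T (transportSp T hT A) : Sp𝕎₂) : 𝕎₂ ≃ₗ[K] 𝕎₂) v) := by
  obtain ⟨x, y⟩ := v
  have h1 : ∀ x' y' : ι → K, (((transportSp T hT A : Sp𝕎) : 𝕎 ≃ₗ[K] 𝕎) (x', y')).1 =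
      (A : Matrix (ι ⊕ ι) (ι ⊕ ι) K).toBlocks₁₁ *ᵥ x' + (A : Matrix (ι ⊕ ι) (ι ⊕ ι) K).toBlocks₁₂ *ᵥ (T *ᵥ y') :=
    fun x' y' => by rw [coe_transportSp_apply_blocks]
  have h2 : ∀ x' y' : ι → K, T *ᵥ (((transportSp T hT A : Sp𝕎) : 𝕎 ≃ₗ[K] 𝕎) (x', y')).2 =
      (A : Matrix (ι ⊕ ι) (ι ⊕ ι) K).toBlocks₂₁ *ᵥ x' + (A : Matrix (ι ⊕ ι) (ι ⊕ ι) K).toBlocks₂₂ *ᵥ (T *ᵥ y') :=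
    fun x' y' => by
      rw [coe_transportSp_apply_blocks]
      dsimp only
      rw [Matrix.mulVec_mulVec, Matrix.mul_nonsing_inv T hT, Matrix.one_mulVec]
  rw [darboux_apply, darboux_apply, coe_spDiag_apply]
  dsimp only
  simp only [diagSpMatrixAux, Matrix.fromBlocks_mulVec, Sum.elim_comp_inl, Sum.elim_comp_inr, Matrix.zero_mulVec,
    Matrix.neg_mulVec, Matrix.mulVec_neg, neg_neg, add_zero, zero_add, h1, h2]
  funext i
  rcases i with (i | i) | (i | i) <;>
    simp only [Sum.elim_inl, Sum.elim_inr, Pi.add_apply, Pi.neg_apply, neg_zero, add_zero, neg_add]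

/-- `D(A) = untransportMatrix (T ⊕ −T) ((P⁻¹AP)^Δ)`. [cite: Kudla1996, V.3] -/
theorem diagSpMatrixAux_eq_untransportMatrix (A : Matrix.symplecticGroup ι K) :
    diagSpMatrixAux (A : Matrix (ι ⊕ ι) (ι ⊕ ι) K) =
      untransportMatrix T₂ (isUnit_det_fromBlocks_neg T hT)
        ((spDiag T (transportSp T hT A) : Sp𝕎₂) : 𝕎₂ ≃ₗ[K] 𝕎₂) :=
  Matrix.ext_iff_mulVec.2 fun u => by
    rw [untransportMatrix_mulVec, ← diagSpMatrixAux_mulVec_darboux T hT, LinearEquiv.apply_symm_apply]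

omit T hT in
/-- `det 1` is a unit. [folklore] -/
private theorem isUnit_det_one' : IsUnit (1 : Matrix ι ι K).det := by
  rw [Matrix.det_one]; exact isUnit_one

/-- **the diagonal at matrix level `Sp_{2ι}(K) →* Sp_{2(ι ⊕ ι)}(K)`, `A ↦ D(A)`** (via the standard Gram matrix
`T = 1`; the value `D(A)` does not depend on `T`, `coe_diagSpMatrix`). [cite: Kudla1996, V.3] -/
def diagSpMatrix : Matrix.symplecticGroup ι K →* Matrix.symplecticGroup (ι ⊕ ι) K :=
  (untransportSp (Matrix.fromBlocks (1 : Matrix ι ι K) 0 0 (-1)) (isUnit_det_fromBlocks_neg 1 isUnit_det_one')).comp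
    ((spDiag (1 : Matrix ι ι K)).comp (transportSp (1 : Matrix ι ι K) isUnit_det_one'))

/-- the matrix of `diagSpMatrix A` is `D(A)`. [cite: Kudla1996, V.3] -/
@[simp] theorem coe_diagSpMatrix (A : Matrix.symplecticGroup ι K) :
    ((diagSpMatrix A : Matrix.symplecticGroup (ι ⊕ ι) K) : Matrix ((ι ⊕ ι) ⊕ (ι ⊕ ι)) ((ι ⊕ ι) ⊕ (ι ⊕ ι)) K) =
      diagSpMatrixAux (A : Matrix (ι ⊕ ι) (ι ⊕ ι) K) :=
  (diagSpMatrixAux_eq_untransportMatrix (1 : Matrix ι ι K) isUnit_det_one' A).symm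

omit T hT in
/-- **the diagonal is defined over the prime ring**: `mapHom f (D A) = D (mapHom f A)`. [cite: Kudla1996, V.3] -/
theorem mapHom_diagSpMatrix {K' : Type*} [CommRing K'] (f : K →+* K') (A : Matrix.symplecticGroup ι K) :
    mapHom f (diagSpMatrix A) = diagSpMatrix (mapHom f A) :=
  Subtype.ext (by rw [coe_mapHom, coe_diagSpMatrix, coe_diagSpMatrix, coe_mapHom, diagSpMatrixAux_map])

/-- **`P₂⁻¹ D(A) P₂ = (P⁻¹AP)^Δ`**: transporting the matrix diagonal gives the diagonal, for EVERY Gram matrix `T`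
with `IsUnit T.det`. [cite: Kudla1996, V.3] -/
theorem transportSp_diagSpMatrix (A : Matrix.symplecticGroup ι K) :
    transportSp T₂ (isUnit_det_fromBlocks_neg T hT) (diagSpMatrix A) = spDiag T (transportSp T hT A) := by
  have h : diagSpMatrix A =
      untransportSp T₂ (isUnit_det_fromBlocks_neg T hT) (spDiag T (transportSp T hT A)) :=
    Subtype.ext (by rw [coe_diagSpMatrix, coe_untransportSp, diagSpMatrixAux_eq_untransportMatrix T hT])
  rw [h, transportSp_untransportSp]

end Diagonal

/-! ## §3 Reindexing preserves the Siegel parabolic -/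

section Reindex

variable {K : Type*} [CommRing K] {ι ι' : Type*} [Fintype ι] [Fintype ι'] [DecidableEq ι] [DecidableEq ι']
  (e : ι ≃ ι') (T : Matrix ι ι K)

local notation "𝕎" => (ι → K) × (ι → K)
local notation "𝕎'" => (ι' → K) × (ι' → K)
local notation "Sp𝕎" => symplecticGroup (polar (Matrix.toLinearMap₂' K T))
local notation "Sp𝕎'" => symplecticGroup (polar (Matrix.toLinearMap₂' K (Matrix.reindex e e T)))

/-- **`spReindex e` carries `P_Y(W_T)` into `P_Y(W_{reindex T})`** (a renumbering acts coordinatewise on `X` and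
on `Y`). [cite: Weil1964, Chap. III n° 46 p. 201] -/
theorem spReindex_mem_siegelParabolicPi {p : Sp𝕎} (hp : p ∈ siegelParabolicPi T) :
    spReindex e T p ∈ siegelParabolicPi (Matrix.reindex e e T) := by
  have h₁ : ∀ y : ι → K, (((p : Sp𝕎) : 𝕎 ≃ₗ[K] 𝕎) (0, y)).1 = 0 := hp.1
  have h₂ : ∀ y : ι → K, ((((p⁻¹ : Sp𝕎)) : 𝕎 ≃ₗ[K] 𝕎) (0, y)).1 = 0 := hp.2
  refine ⟨fun y => ?_, fun y => ?_⟩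
  · simp only [coe_spReindex_apply, reindexW_symm_apply, reindexW_apply, Pi.zero_comp, h₁]
  · have h : ((spReindex e T p : Sp𝕎') : 𝕎' ≃ₗ[K] 𝕎').symm (0, y) =
        ((spReindex e T p⁻¹ : Sp𝕎') : 𝕎' ≃ₗ[K] 𝕎') (0, y) := by
      rw [map_inv]; rfl
    rw [h]
    simp only [coe_spReindex_apply, reindexW_symm_apply, reindexW_apply, Pi.zero_comp, h₂]

/-- **`P_Y(W_T) →* P_Y(W_{reindex T})`** along `e : ι ≃ ι′`. [cite: Weil1964, Chap. III n° 46 p. 201] -/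
def siegelParabolicPiReindex : siegelParabolicPi T →* siegelParabolicPi (Matrix.reindex e e T) :=
  ((spReindex e T).comp (siegelParabolicPi T).subtype).codRestrict _ fun p =>
    spReindex_mem_siegelParabolicPi e T p.2

/-- underlying element. [cite: Weil1964, Chap. III n° 46 p. 201] -/
@[simp] theorem coe_siegelParabolicPiReindex (p : siegelParabolicPi T) :
    (siegelParabolicPiReindex e T p : Sp𝕎') = spReindex e T p := rfl

end Reindex

/-! ## §4 The adelic doubling lift `S̃ : Sp(W_𝔸) →* Mp_ψ((W ⊕ W⁻)_𝔸)ᶜᵒⁿᵗ` -/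

section DoublingLift

variable (F : Type) [Field F] [NumberField F] {n : ℕ}
variable (T : Matrix (Fin n) (Fin n) (AdeleRing (𝓞 F) F)) (hT : IsUnit T.det)

local notation "𝔸F" => AdeleRing (𝓞 F) F
local notation "Sp𝔸" => symplecticGroup (polar (adelicForm F (Fin n) T))
local notation "T₂" => Matrix.fromBlocks T 0 0 (-T)

/-- **the doubled Gram matrix** `(T ⊕ −T)` renumbered by `Fin (n + n)`: the Gram matrix of `W ⊕ W⁻` in the currency
(`Fin m`) of `AdelicSiegelParabolicLift` and `AdelicMetaplecticGenerators`.  A (reducible) definition, so that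
the large matrix term stays folded in the terms below. [cite: Kudla1996, V.3] -/
abbrev doubledGramFin : Matrix (Fin (n + n)) (Fin (n + n)) 𝔸F :=
  Matrix.reindex finSumFinEquiv finSumFinEquiv (Matrix.fromBlocks T 0 0 (-T))

/-- unfolding. [cite: Kudla1996, V.3] -/
theorem doubledGramFin_eq : doubledGramFin F T = Matrix.reindex finSumFinEquiv finSumFinEquiv (Matrix.fromBlocks T 0 0 (-T)) :=
  rfl

local notation "𝕋" => doubledGramFin F T
local notation "Sp𝕋" => symplecticGroup (polar (adelicForm F (Fin (n + n)) (doubledGramFin F T)))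
local notation "Sp𝕎₂A" => symplecticGroup (polar (Matrix.toLinearMap₂' (AdeleRing (𝓞 F) F) (Matrix.fromBlocks T 0 0 (-T))))

include hT in
/-- `det (T ⊕ −T)` renumbered is a unit (the doubled space is non-degenerate). [cite: Kudla1996, V.3] -/
theorem isUnit_det_doubledGramFin : IsUnit (doubledGramFin F T).det :=
  isUnit_det_reindex finSumFinEquiv _ (isUnit_det_fromBlocks_neg T hT)

/-- **`g ↦ δ g^Δ δ⁻¹ ∈ P_𝕐(𝔸)`, renumbered by `Fin (n + n)`**: `Sp(W_𝔸) →* P_Y((W ⊕ W⁻)_𝔸)`.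
[cite: GelbartPiatetskishapiroRallis1987, Part A §2 pp. 7–9] -/
def doublingParabolicFin : Sp𝔸 →* siegelParabolicPi 𝕋 :=
  (siegelParabolicPiReindex finSumFinEquiv T₂).comp (doublingParabolic T hT)

/-- underlying element. [cite: GelbartPiatetskishapiroRallis1987, Part A §2 pp. 7–9] -/
theorem coe_doublingParabolicFin (g : Sp𝔸) :
    ((doublingParabolicFin F T hT g : siegelParabolicPi 𝕋) : Sp𝕋) =
      spReindex finSumFinEquiv T₂ (doublingDelta T hT * spDiag T g * (doublingDelta T hT)⁻¹) :=
  rfl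

/-- `δ` as a RATIONAL symplectic matrix on `Fin (n + n)`. [cite: Li1992, p. 181] -/
def doublingDeltaRat : Matrix.symplecticGroup (Fin (n + n)) F :=
  spMatrixReindex finSumFinEquiv (deltaDiag F (Fin n))

/-- **`ratSp δ_F = δ` renumbered**: `δ` is a rational point of `Sp((W ⊕ W⁻)_𝔸)`. [cite: Li1992, p. 181] -/
theorem ratSp_doublingDeltaRat :
    ratSp F 𝕋 (isUnit_det_doubledGramFin F T hT) (doublingDeltaRat F) =
      spReindex finSumFinEquiv T₂ (doublingDelta T hT) := by
  have hδ : doublingDelta T hT =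
      ratSpι F (Fin n ⊕ Fin n) T₂ (isUnit_det_fromBlocks_neg T hT) (deltaDiag F (Fin n)) := by
    rw [doublingDelta, ← mapHom_deltaDiag (algebraMap F 𝔸F)]; rfl
  rw [hδ, spReindex_ratSpι]; rfl

/-- **the diagonal of a rational point is a rational point**: `(ratSp γ)^Δ = ratSpι (D γ)`.
[cite: Weil1964, Chap. III n° 37 p. 188] -/
theorem spDiag_ratSp (γ : Matrix.symplecticGroup (Fin n) F) :
    spDiag T (ratSp F T hT γ) = ratSpι F (Fin n ⊕ Fin n) T₂ (isUnit_det_fromBlocks_neg T hT) (diagSpMatrix γ) := by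
  show spDiag T (transportSp T hT (mapHom (algebraMap F 𝔸F) γ)) =
    transportSp T₂ (isUnit_det_fromBlocks_neg T hT) (mapHom (algebraMap F 𝔸F) (diagSpMatrix γ))
  rw [← transportSp_diagSpMatrix T hT, mapHom_diagSpMatrix]

/-- the same renumbered by `Fin (n + n)`: `(ratSp γ)^Δ = ratSp (D γ)` in `Sp((W ⊕ W⁻)_𝔸)`.
[cite: Weil1964, Chap. III n° 37 p. 188] -/
theorem spReindex_spDiag_ratSp (γ : Matrix.symplecticGroup (Fin n) F) :
    spReindex finSumFinEquiv T₂ (spDiag T (ratSp F T hT γ)) =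
      ratSp F 𝕋 (isUnit_det_doubledGramFin F T hT) (spMatrixReindex finSumFinEquiv (diagSpMatrix γ)) := by
  rw [spDiag_ratSp, spReindex_ratSpι]; rfl

/-- the diagonal of a rational point, as an element of the rational range subgroup of `Sp((W ⊕ W⁻)_𝔸)`.
[cite: Weil1964, Chap. III n° 37 p. 188] -/
theorem spReindex_spDiag_ratSp_mem_range (γ : Matrix.symplecticGroup (Fin n) F) :
    spReindex finSumFinEquiv T₂ (spDiag T (ratSp F T hT γ)) ∈
      ((transportSp 𝕋 (isUnit_det_doubledGramFin F T hT)).comp (mapHom (algebraMap F 𝔸F))).range :=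
  ⟨spMatrixReindex finSumFinEquiv (diagSpMatrix γ), (spReindex_spDiag_ratSp F T hT γ).symm⟩

/-- `r_F(δ) ∈ Mp_ψ((W ⊕ W⁻)_𝔸)ᶜᵒⁿᵗ`, Weil's lift of the rational point `δ`. [cite: Weil1964, Chap. III n° 40 p. 190] -/
def doublingDeltaLift : adelicMpCont F (Fin (n + n)) 𝕋 :=
  ratThetaLiftCont F 𝕋 (isUnit_det_doubledGramFin F T hT) (doublingDeltaRat F)

/-- `π(r_F(δ)) = δ` (renumbered). [cite: Weil1964, Chap. III n° 40 p. 190] -/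
theorem proj_doublingDeltaLift :
    adelicMpCont.proj F (Fin (n + n)) 𝕋 (doublingDeltaLift F T hT) = spReindex finSumFinEquiv T₂ (doublingDelta T hT) :=
  (proj_ratThetaLiftCont F 𝕋 (isUnit_det_doubledGramFin F T hT) (doublingDeltaRat F)).trans (ratSp_doublingDeltaRat F T hT)

/-- **`p ↦ δ p δ⁻¹ ∈ P_𝕐(𝔸)` on the adelic stabiliser of `W^Δ`, renumbered by `Fin (n + n)`**. [cite: Li1992, p. 181] -/
def stabDiagParabolicFin : stabDiag T →* siegelParabolicPi 𝕋 :=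
  (siegelParabolicPiReindex finSumFinEquiv T₂).comp (stabDiagParabolic T hT)

/-- underlying element. [cite: Li1992, p. 181] -/
theorem coe_stabDiagParabolicFin (p : stabDiag T) :
    ((stabDiagParabolicFin F T hT p : siegelParabolicPi 𝕋) : Sp𝕋) =
      spReindex finSumFinEquiv T₂ (doublingDelta T hT * p * (doublingDelta T hT)⁻¹) :=
  rfl

/-- **THE CANONICAL LIFT OVER THE ADELIC STABILISER OF THE RATIONAL LAGRANGIAN `W^Δ`**:
`Stab(W^Δ)(𝔸) →* Mp_ψ((W ⊕ W⁻)_𝔸)ᶜᵒⁿᵗ`, `p ↦ r_F(δ)⁻¹ · 𝐫₀(δ p δ⁻¹) · r_F(δ)` — Weil's `𝐫₀` over the Siegel parabolic of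
`𝕐 = δ(W^Δ)` conjugated back by the `Θ`-forced rational lift of `δ` (the splitting over "`P` preserving `V^d`" of the
doubling method). [cite: Weil1964, Chap. I n° 13 p. 160; GelbartPiatetskishapiroRallis1987, Part A §2 pp. 7–9] -/
def stabDiagLift : stabDiag T →* adelicMpCont F (Fin (n + n)) 𝕋 where
  toFun p := (doublingDeltaLift F T hT)⁻¹ *
    adelicSiegelLiftCont F 𝕋 (isUnit_det_doubledGramFin F T hT) (stabDiagParabolicFin F T hT p) * doublingDeltaLift F T hT
  map_one' := by simp only [map_one, mul_one, inv_mul_cancel]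
  map_mul' p q := by
    simp only [map_mul]
    group

/-- unfolding. [cite: Weil1964, Chap. I n° 13 p. 160] -/
theorem stabDiagLift_apply (p : stabDiag T) :
    stabDiagLift F T hT p = (doublingDeltaLift F T hT)⁻¹ *
      adelicSiegelLiftCont F 𝕋 (isUnit_det_doubledGramFin F T hT) (stabDiagParabolicFin F T hT p) *
        doublingDeltaLift F T hT :=
  rfl

/-- **`π ∘ (lift) = ` the inclusion `Stab(W^Δ)(𝔸) ≤ Sp((W ⊕ W⁻)_𝔸)`** (renumbered). [cite: Weil1964, Chap. I n° 13 p. 160] -/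
theorem proj_stabDiagLift (p : stabDiag T) :
    adelicMpCont.proj F (Fin (n + n)) 𝕋 (stabDiagLift F T hT p) = spReindex finSumFinEquiv T₂ (p : Sp𝕎₂A) := by
  simp only [stabDiagLift_apply, map_mul, map_inv, proj_adelicSiegelLiftCont, proj_doublingDeltaLift,
    coe_stabDiagParabolicFin, mul_assoc, inv_mul_cancel_left, inv_mul_cancel, mul_one]

/-- **RATIONALITY**: at a RATIONAL point `p` of `Stab(W^Δ)(𝔸)` the lift fixes `Θ` — `r_F(δ)^{±1}` do by Weil's Théorème 6,
and `𝐫₀(δ p δ⁻¹)` does because `δ p δ⁻¹` is a rational point of `P_𝕐(𝔸)` (`adelicSiegelLift_mem_adelicMpTheta_of_mem_range`).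
[cite: Weil1964, Chap. III n° 41 Thm 6 p. 193] -/
theorem stabDiagLift_mem_adelicMpTheta {p : stabDiag T}
    (hp : spReindex finSumFinEquiv T₂ (p : Sp𝕎₂A) ∈ (ratSp F 𝕋 (isUnit_det_doubledGramFin F T hT)).range) :
    (stabDiagLift F T hT p).val ∈ adelicMpTheta F (Fin (n + n)) 𝕋 := by
  have hmem : ((stabDiagParabolicFin F T hT p : siegelParabolicPi 𝕋) : Sp𝕋) ∈
      (ratSp F 𝕋 (isUnit_det_doubledGramFin F T hT)).range := by
    simp only [coe_stabDiagParabolicFin, map_mul, map_inv, ← ratSp_doublingDeltaRat F T hT]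
    exact Subgroup.mul_mem _ (Subgroup.mul_mem _ ⟨_, rfl⟩ hp) (Subgroup.inv_mem _ ⟨_, rfl⟩)
  -- membership is checked in the pulled-back subgroup `Θ ∩ Mp_ψᶜᵒⁿᵗ` of `adelicMpCont`, factor by factor
  have key : stabDiagLift F T hT p ∈
      (adelicMpTheta F (Fin (n + n)) 𝕋).comap (adelicMpCont F (Fin (n + n)) 𝕋).subtype := by
    simp only [stabDiagLift_apply]
    refine Subgroup.mul_mem _ (Subgroup.mul_mem _ (Subgroup.inv_mem _ ?_) ?_) ?_
    · exact coe_ratThetaLiftCont_mem_adelicMpTheta F 𝕋 (isUnit_det_doubledGramFin F T hT) (doublingDeltaRat F)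
    · exact adelicSiegelLift_mem_adelicMpTheta_of_mem_range F 𝕋 (isUnit_det_doubledGramFin F T hT) hmem
    · exact coe_ratThetaLiftCont_mem_adelicMpTheta F 𝕋 (isUnit_det_doubledGramFin F T hT) (doublingDeltaRat F)
  exact key

/-- **`= r_F` AT RATIONAL POINTS**: at a rational point of `Stab(W^Δ)(𝔸)` the lift IS Weil's `Θ`-forced rational lift
(`Θ`-rigidity). [cite: Weil1964, Chap. III n° 41 Thm 6 p. 193] -/
theorem stabDiagLift_eq_ratPointsThetaLiftCont {p : stabDiag T}
    (hp : spReindex finSumFinEquiv T₂ (p : Sp𝕎₂A) ∈ (ratSp F 𝕋 (isUnit_det_doubledGramFin F T hT)).range) :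
    stabDiagLift F T hT p = ratPointsThetaLiftCont F (Fin (n + n)) 𝕋 (isUnit_det_doubledGramFin F T hT) ⟨_, hp⟩ :=
  Subtype.ext (coe_ratPointsThetaLiftCont_eq F (Fin (n + n)) 𝕋 (isUnit_det_doubledGramFin F T hT) (g := ⟨_, hp⟩)
    (stabDiagLift_mem_adelicMpTheta F T hT hp)
    ((adelicMpCont.proj_apply _).symm.trans (proj_stabDiagLift F T hT p))).symm

/-- **THE DOUBLING LIFT `S̃ : Sp(W_𝔸) →* Mp_ψ((W ⊕ W⁻)_𝔸)ᶜᵒⁿᵗ`**, `S̃(g) = r_F(δ)⁻¹ · 𝐫₀(δ g^Δ δ⁻¹) · r_F(δ)`: the lift over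
`Stab(W^Δ)(𝔸)` composed with the diagonal — a canonical HOMOMORPHIC lift of `g ↦ g^Δ`.
[cite: Weil1964, Chap. I n° 13 p. 160; GelbartPiatetskishapiroRallis1987, Part A §2 pp. 7–9] -/
def doublingLift : Sp𝔸 →* adelicMpCont F (Fin (n + n)) 𝕋 := (stabDiagLift F T hT).comp (spDiagStab T)

/-- `S̃(g)` is the stabiliser lift at `g^Δ`. [cite: Weil1964, Chap. I n° 13 p. 160] -/
theorem doublingLift_eq_stabDiagLift (g : Sp𝔸) :
    doublingLift F T hT g = stabDiagLift F T hT (spDiagStab T g) := rfl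

/-- unfolding: `S̃(g) = r_F(δ)⁻¹ 𝐫₀(δ g^Δ δ⁻¹) r_F(δ)`. [cite: Weil1964, Chap. I n° 13 p. 160] -/
theorem doublingLift_apply (g : Sp𝔸) :
    doublingLift F T hT g = (doublingDeltaLift F T hT)⁻¹ *
      adelicSiegelLiftCont F 𝕋 (isUnit_det_doubledGramFin F T hT) (doublingParabolicFin F T hT g) *
        doublingDeltaLift F T hT :=
  rfl

/-- **`π(S̃ g) = g^Δ`** (renumbered by `Fin (n + n)`). [cite: Weil1964, Chap. I n° 13 p. 160] -/
theorem proj_doublingLift (g : Sp𝔸) :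
    adelicMpCont.proj F (Fin (n + n)) 𝕋 (doublingLift F T hT g) = spReindex finSumFinEquiv T₂ (spDiag T g) :=
  proj_stabDiagLift F T hT (spDiagStab T g)

/-- **RATIONALITY OF THE DOUBLING LIFT**: at a rational point `g = ratSp γ` of `Sp(W_𝔸)`, `S̃(g)` fixes `Θ`.
[cite: Weil1964, Chap. III n° 41 Thm 6 p. 193] -/
theorem doublingLift_ratSp_mem_adelicMpTheta (γ : Matrix.symplecticGroup (Fin n) F) :
    (doublingLift F T hT (ratSp F T hT γ)).val ∈ adelicMpTheta F (Fin (n + n)) 𝕋 :=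
  stabDiagLift_mem_adelicMpTheta F T hT (p := spDiagStab T (ratSp F T hT γ)) (spReindex_spDiag_ratSp_mem_range F T hT γ)

/-- **`S̃ = r_F ∘ Δ` ON `Sp_F(W)`**: at a rational point the doubling lift IS Weil's `Θ`-forced lift of the (rational)
diagonal point. [cite: Weil1964, Chap. III n° 41 Thm 6 p. 193] -/
theorem doublingLift_ratSp (γ : Matrix.symplecticGroup (Fin n) F) :
    doublingLift F T hT (ratSp F T hT γ) =
      ratPointsThetaLiftCont F (Fin (n + n)) 𝕋 (isUnit_det_doubledGramFin F T hT)
        ⟨_, spReindex_spDiag_ratSp_mem_range F T hT γ⟩ :=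
  (doublingLift_eq_stabDiagLift F T hT (ratSp F T hT γ)).trans
    (stabDiagLift_eq_ratPointsThetaLiftCont F T hT (p := spDiagStab T (ratSp F T hT γ))
      (spReindex_spDiag_ratSp_mem_range F T hT γ))

end DoublingLift

/-! ## §5 The doubling splitting datum and the compatibility of `S̃` -/

section Datum

open Literature.NumberTheory.GelbartRogawski1991

variable (F : Type) [Field F] [NumberField F] {n : ℕ}
variable (T : Matrix (Fin n) (Fin n) (AdeleRing (𝓞 F) F)) (hT : IsUnit T.det)

local notation "𝔸F" => AdeleRing (𝓞 F) F
local notation "Sp𝔸" => symplecticGroup (polar (adelicForm F (Fin n) T))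
local notation "T₂" => Matrix.fromBlocks T 0 0 (-T)
local notation "𝕋" => doubledGramFin F T
local notation "Sp𝕋" => symplecticGroup (polar (adelicForm F (Fin (n + n)) (doubledGramFin F T)))

local notation "Sp𝕎₂A" => symplecticGroup (polar (Matrix.toLinearMap₂' (AdeleRing (𝓞 F) F) (Matrix.fromBlocks T 0 0 (-T))))

/-- **The splitting datum of the stabiliser of `W^Δ`** ([GelbartRogawski1991, §3.1 p. 454] at `Sp := Sp((W ⊕ W⁻)_𝔸)`,
`Mp := Mp_ψ((W ⊕ W⁻)_𝔸)ᶜᵒⁿᵗ`, `π := proj`, **`G(𝐀) := Stab(W^Δ)(𝔸)`** (inclusion, renumbered), `G(F) :=` ALL its rational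
points, `Sp_F := ratSp(Sp_{4n}(F))`, `i := r_F`).  All fields constructed. [cite: GelbartRogawski1991, §3.1 p. 454 L21–48] -/
def stabDiagSplittingDatum : SplittingDatum Sp𝕋 (adelicMpCont F (Fin (n + n)) 𝕋) (stabDiag T) where
  proj := adelicMpCont.proj F (Fin (n + n)) 𝕋
  toSp := (spReindex finSumFinEquiv T₂).comp (stabDiag T).subtype
  ratPts := ((ratSp F 𝕋 (isUnit_det_doubledGramFin F T hT)).range).comap ((spReindex finSumFinEquiv T₂).comp (stabDiag T).subtype)
  spRat := ((transportSp 𝕋 (isUnit_det_doubledGramFin F T hT)).comp (mapHom (algebraMap F 𝔸F))).range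
  toSp_mem_spRat _ hp := hp
  ratSplit := ratPointsThetaLiftCont F (Fin (n + n)) 𝕋 (isUnit_det_doubledGramFin F T hT)
  proj_ratSplit := proj_ratPointsThetaLiftCont F (Fin (n + n)) 𝕋 _

/-- **THE METAPLECTIC COVER OF THE DOUBLED SPACE ADMITS A COMPATIBLE SPLITTING OVER THE ADELIC STABILISER OF THE
RATIONAL LAGRANGIAN `W^Δ`** (homomorphic, over the inclusion, EVERY rational point into `r_F(Sp_F(W ⊕ W⁻))`):
`(stabDiagSplittingDatum F T hT).IsCompatible (stabDiagLift F T hT)`.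
[cite: GelbartRogawski1991, §3.1 Remark p. 457 L4; Weil1964, Chap. III n° 41 Thm 6 p. 193] -/
theorem isCompatible_stabDiagLift : (stabDiagSplittingDatum F T hT).IsCompatible (stabDiagLift F T hT) :=
  ⟨fun p => proj_stabDiagLift F T hT p, fun _ hp => ⟨⟨_, hp⟩, (stabDiagLift_eq_ratPointsThetaLiftCont F T hT hp).symm⟩⟩

/-- **The doubling splitting datum** of [GelbartRogawski1991, §3.1 p. 454] at `Sp := Sp((W ⊕ W⁻)_𝔸)`,
`Mp := Mp_ψ((W ⊕ W⁻)_𝔸)ᶜᵒⁿᵗ`, `π := proj`, **`G(𝐀) := Sp(W_𝔸)`** with `ι := Δ` (the diagonal), `G(F) := Sp_F(W)`,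
`Sp_F(W ⊕ W⁻) := ratSp(Sp_{4n}(F))`, `i := r_F`.  All fields constructed. [cite: GelbartRogawski1991, §3.1 p. 454 L21–48] -/
def doublingSplittingDatum : SplittingDatum Sp𝕋 (adelicMpCont F (Fin (n + n)) 𝕋) Sp𝔸 where
  proj := adelicMpCont.proj F (Fin (n + n)) 𝕋
  toSp := (spReindex finSumFinEquiv T₂).comp (spDiag T)
  ratPts := (ratSp F T hT).range
  spRat := ((transportSp 𝕋 (isUnit_det_doubledGramFin F T hT)).comp (mapHom (algebraMap F 𝔸F))).range
  toSp_mem_spRat g hg := by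
    obtain ⟨γ, rfl⟩ := hg
    exact spReindex_spDiag_ratSp_mem_range F T hT γ
  ratSplit := ratPointsThetaLiftCont F (Fin (n + n)) 𝕋 (isUnit_det_doubledGramFin F T hT)
  proj_ratSplit := proj_ratPointsThetaLiftCont F (Fin (n + n)) 𝕋 _

/-- **THE DOUBLING LIFT IS COMPATIBLE**: `S̃ : Sp(W_𝔸) →* Mp_ψ((W ⊕ W⁻)_𝔸)ᶜᵒⁿᵗ` lies over the diagonal and carries
`Sp_F(W)` into `r_F(Sp_F(W ⊕ W⁻))` — `(doublingSplittingDatum F T hT).IsCompatible (doublingLift F T hT)`.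
[cite: GelbartRogawski1991, §3.1 Remark p. 457 L4; Weil1964, Chap. III n° 41 Thm 6 p. 193] -/
theorem isCompatible_doublingLift : (doublingSplittingDatum F T hT).IsCompatible (doublingLift F T hT) := by
  refine ⟨fun g => proj_doublingLift F T hT g, fun g hg => ?_⟩
  obtain ⟨γ, rfl⟩ := hg
  exact ⟨⟨_, spReindex_spDiag_ratSp_mem_range F T hT γ⟩, (doublingLift_ratSp F T hT γ).symm⟩

end Datum

end Literature.NumberTheory.Weil1964

end
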